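import Mathlib
import Summits.ResolutionOfSingularities.ResolutionOfSingularities.Theses.ShadowGame
import Summits.ResolutionOfSingularities.ResolutionOfSingularities.Theorems.ShadowGameWin.Negative.Mirror

/-!
# `ShadowGameWinR` (crux stmt-ResolutionOfSingularities-18182, route `ShadowGame`) — SKELETON of the refutation

B wins the repaired game `SG^R_p(3)` for EVERY prime `p` (perfect-information, with FIXED answers):
start `c₀ = x · Π₀^p`, `Π₀ = (1-x)³ y² − W³`, `W = z − x − xz` (a surface with a cuspidal edge along the
non-coordinate curve `{y = 0, z = x/(1-x)}`); B answers every centre `F ∋ x` in the chart `x` with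
translations `τ_y = 0, τ_z = 1`, the centre `{y,z}` in the chart `z` with `τ_y = 0`, and singletons trivially.
Then every position is `x · Π^p · E^p` with `Π = x^a z^{2e} U y² − x^b W³` (`U`, `E` units), never terminal′
(weighted-initial-form certificate through the shear `z ↦ z + x/(1-x)`).

This file: named mirror of the rev-3 terminal test, the stub statements, and (later) the assembly.
-/

noncomputable section

set_option linter.dupNamespace false

namespace Summit.ResolutionOfSingularities.ResolutionOfSingularities.Theorems.ShadowGameWinR.Negative

open Summit.ResolutionOfSingularities.ResolutionOfSingularities.Theses.ShadowGame (ShadowGameWinR)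
open Summit.ResolutionOfSingularities.ResolutionOfSingularities.Theorems.ShadowGameWin.Negative
  (clean bl mF dv tr step shadow play play_succ)
open MvPowerSeries

section Mirror

variable {n : ℕ} {κ : Type} [Field κ] (p : ℕ)

/-- The rev-3 terminal test `Terminal′` of `ShadowGameWinR` (verbatim body, names for the let-bound
`clean`). [folklore] -/
def TerminalR (c : (Fin n → ℕ) → κ) : Prop :=
  (∀ A, clean p c A = 0) ∨
  (∃ A, clean p c A ≠ 0 ∧ (Finset.sum Finset.univ (fun j => A j) ≤ 1 ∨
    ∀ B, clean p c B ≠ 0 → ∀ j, A j ≤ B j)) ∨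
  ∃ (w : Fin n → MvPowerSeries (Fin n) κ) (A : Fin n → ℕ) (v g : MvPowerSeries (Fin n) κ),
    Ideal.span (Set.range w) = IsLocalRing.maximalIdeal (MvPowerSeries (Fin n) κ) ∧
    (∃ j, ¬ p ∣ A j) ∧ IsUnit v ∧
    ∀ B : Fin n →₀ ℕ, clean p c ⇑B =
      MvPowerSeries.coeff B (Finset.prod Finset.univ (fun j => w j ^ A j) * v + g ^ p)

end Mirror

/-- `A wins SG^R_p(n)`: the inner statement of `ShadowGameWinR` at `(p, n)`. [folklore] -/
def AWinsR (p n : ℕ) : Prop :=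
  ∃ strat : List (Set (Fin n → ℚ)) → List (Fin n) → Finset (Fin n),
    (∀ hs js, (strat hs js).Nonempty) ∧
    ∀ (κ : Type) [Field κ] [CharP κ p] [PerfectField κ] (c₀ : (Fin n → ℕ) → κ) (i : ℕ → Fin n)
      (t : ℕ → Fin n → κ),
      (∀ m, i m ∈ strat (play p strat c₀ i t m).2.1 (play p strat c₀ i t m).2.2) →
        ∃ m, TerminalR p (play p strat c₀ i t m).1

/-- The route decl is, definitionally, `∀ p prime, ∀ n ≥ 1, AWinsR p n`. [folklore] -/
theorem shadowGameWinR_iff : ShadowGameWinR ↔ ∀ p : ℕ, p.Prime → ∀ n : ℕ, 0 < n → AWinsR p n :=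
  Iff.rfl

/-! ## Coefficient functions vs. `MvPowerSeries` -/

section Bridge

variable {n : ℕ} {κ : Type} [Field κ]

/-- A coefficient function as a formal power series. [folklore] -/
def ser (c : (Fin n → ℕ) → κ) : MvPowerSeries (Fin n) κ := fun d => c ⇑d

/-- A formal power series as a coefficient function. [folklore] -/
def fn (f : MvPowerSeries (Fin n) κ) : (Fin n → ℕ) → κ :=
  fun A => MvPowerSeries.coeff (Finsupp.equivFunOnFinite.symm A) f

/-- `fn ∘ ser = id`. [folklore] -/
theorem fn_ser (c : (Fin n → ℕ) → κ) : fn (ser c) = c := by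
  funext A
  show (ser c) (Finsupp.equivFunOnFinite.symm A) = c A
  simp [ser]

/-- `ser ∘ fn = id`. [folklore] -/
theorem ser_fn (f : MvPowerSeries (Fin n) κ) : ser (fn f) = f := by
  funext d
  show f (Finsupp.equivFunOnFinite.symm ⇑d) = f d
  simp

end Bridge

/-! ## B's fixed answers and the position family (n = 3) -/

section Family

variable {κ : Type} [Field κ]

/-- B's chart: `x` if allowed, else `z` if allowed, else `y`. [folklore] -/
def chartR (F : Finset (Fin 3)) : Fin 3 :=
  if (0 : Fin 3) ∈ F then 0 else if (2 : Fin 3) ∈ F then 2 else 1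

variable (κ) in
/-- B's translation (constant): `τ_z = 1`, `τ_x = τ_y = 0`. [folklore] -/
def tauR : Fin 3 → κ := fun j => if j = 2 then 1 else 0

/-- The edge coordinate `W = z − x − x z` (its zero set with `y = 0` is the curve B follows).
[folklore] -/
def Wp : MvPowerSeries (Fin 3) κ := X 2 - X 0 - X 0 * X 2

/-- The surface `Π(a,e,b,U) = x^a z^{2e} U y² − x^b W³`. [folklore] -/
def PiSt (a e b : ℕ) (U : MvPowerSeries (Fin 3) κ) : MvPowerSeries (Fin 3) κ :=
  X 0 ^ a * X 2 ^ (2 * e) * U * X 1 ^ 2 - X 0 ^ b * Wp ^ 3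

/-- The position `x · Π^p · E^p`. [folklore] -/
def posSt (p a e b : ℕ) (U E : MvPowerSeries (Fin 3) κ) : MvPowerSeries (Fin 3) κ :=
  X 0 * PiSt a e b U ^ p * E ^ p

/-- The substitution realising B's answer to the centre `F` in the chart `i` with translation `τ`:
`u_i ↦ u_i`, `u_j ↦ u_i (u_j + τ_j)` for `j ∈ F ∖ {i}`, `u_k ↦ u_k` otherwise. [folklore] -/
def substMap (F : Finset (Fin 3)) (i : Fin 3) (τ : Fin 3 → κ) : Fin 3 → MvPowerSeries (Fin 3) κ :=
  fun j => if j = i then X i else if j ∈ F then X i * (X j + C (τ j)) else X j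

end Family

/-! ## STUBS -/

section Stubs

/-- STUB S3 (derivations): the coordinate derivations `∂/∂u_i` of `κ⟦u₀,u₁,u₂⟧` in characteristic `p`:
linear, Leibniz, kill `p`-th powers, with the expected coefficient formula. -/
theorem stub_deriv (p : ℕ) [Fact p.Prime] (κ : Type) [Field κ] [CharP κ p] :
    ∃ D : Fin 3 → (MvPowerSeries (Fin 3) κ →ₗ[κ] MvPowerSeries (Fin 3) κ),
      (∀ i (f : MvPowerSeries (Fin 3) κ) (d : Fin 3 →₀ ℕ),
          coeff d (D i f) = ((d i + 1 : ℕ) : κ) * coeff (d + Finsupp.single i 1) f) ∧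
      (∀ i (f g : MvPowerSeries (Fin 3) κ), D i (f * g) = f * D i g + g * D i f) ∧
      (∀ i (g : MvPowerSeries (Fin 3) κ), D i (g ^ p) = 0) ∧
      (∀ i j, D i (X j : MvPowerSeries (Fin 3) κ) = if i = j then 1 else 0) := by
  sorry

/-- STUB S4 (structure of the Jacobian ideal of a terminal′ series): if `f = w^A · v + g^p` with `w`
having invertible linear part, `v` a unit and `p ∤ A k`, then `(∏_j w_j^{A_j − [p ∤ A_j]}) · ∏_{j ≠ k, p ∤ A_j} w_j`
lies in the ideal generated by the partial derivatives of `f` (for ANY family of operators `D` that is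
Leibniz and kills `p`-th powers). -/
theorem stub_structure (p : ℕ) [Fact p.Prime] (κ : Type) [Field κ] [CharP κ p]
    (D : Fin 3 → (MvPowerSeries (Fin 3) κ →ₗ[κ] MvPowerSeries (Fin 3) κ))
    (hL : ∀ i (f g : MvPowerSeries (Fin 3) κ), D i (f * g) = f * D i g + g * D i f)
    (hP : ∀ i (g : MvPowerSeries (Fin 3) κ), D i (g ^ p) = 0)
    (w : Fin 3 → MvPowerSeries (Fin 3) κ) (hw0 : ∀ j, constantCoeff (w j) = 0)
    (hdet : IsUnit (Matrix.det (Matrix.of fun i j => constantCoeff (D i (w j)))))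
    (A : Fin 3 → ℕ) (k : Fin 3) (hk : ¬ p ∣ A k) (v g f : MvPowerSeries (Fin 3) κ) (hv : IsUnit v)
    (hf : f = (Finset.prod Finset.univ fun j => w j ^ A j) * v + g ^ p) :
    (Finset.prod Finset.univ fun j => w j ^ (A j - if p ∣ A j then 0 else 1)) *
        (Finset.prod ((Finset.univ.erase k).filter fun j => ¬ p ∣ A j) fun j => w j)
      ∈ Ideal.span (Set.range fun i => D i f) := by
  sorry

/-- STUB S5 (weighted initial forms): for positive weights there is a multiplicative "lowest weighted
homogeneous part" map into polynomials, with the listed properties. -/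
theorem stub_initialForm (κ : Type) [Field κ] (wt : Fin 3 → ℕ) (hwt : ∀ i, 0 < wt i) :
    ∃ ι : MvPowerSeries (Fin 3) κ → MvPolynomial (Fin 3) κ,
      (∀ f, ι f = 0 ↔ f = 0) ∧
      (∀ f g, ι (f * g) = ι f * ι g) ∧
      (∀ f : MvPowerSeries (Fin 3) κ, f ≠ 0 → ∃ N : ℕ,
        (∀ d, Finsupp.weight wt d < N → coeff d f = 0) ∧
        (∃ d, Finsupp.weight wt d = N ∧ coeff d f ≠ 0) ∧
        (∀ d, MvPolynomial.coeff d (ι f) = if Finsupp.weight wt d = N then coeff d f else 0)) := by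
  sorry

/-- STUB S7 (the edge binomials are prime): `c·x^α y² − x^β z³` is prime in `κ[x,y,z]` whenever `c ≠ 0`
and `min α β = 0`. -/
theorem stub_psiPrime (κ : Type) [Field κ] (c : κ) (hc : c ≠ 0) (α β : ℕ) (h : α = 0 ∨ β = 0) :
    Prime (MvPolynomial.C c * MvPolynomial.X 0 ^ α * MvPolynomial.X 1 ^ 2 -
      MvPolynomial.X 0 ^ β * MvPolynomial.X 2 ^ 3 : MvPolynomial (Fin 3) κ) := by
  sorry

/-- STUB S8 (dictionary): one move of the game IS "substitute, divide by `u_i^s`, clean".  For a clean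
series `f` (no coefficient on `pℕ³`) and `s = p ⌊m_F / p⌋`, if the substituted series factors as
`u_i^s · g` then `step` returns the cleaning of `g`. (Def-free statement: `fn f = fun A => coeff (equivFunOnFinite.symm A) f`.) -/
theorem stub_dictionary (p : ℕ) [Fact p.Prime] (κ : Type) [Field κ] [CharP κ p] (F : Finset (Fin 3)) (i : Fin 3) (hi : i ∈ F) (τ : Fin 3 → κ)
    (f g : MvPowerSeries (Fin 3) κ)
    (hclean : ∀ d : Fin 3 →₀ ℕ, (∀ j, p ∣ d j) → coeff d f = 0)
    (s : ℕ) (hs : s = p * (mF F (fun A : Fin 3 → ℕ => coeff (Finsupp.equivFunOnFinite.symm A) f) / p))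
    (hfac : subst (fun j : Fin 3 => if j = i then (X i : MvPowerSeries (Fin 3) κ)
        else if j ∈ F then X i * (X j + C (τ j)) else X j) f = X i ^ s * g) :
    step p F i τ (fun A : Fin 3 → ℕ => coeff (Finsupp.equivFunOnFinite.symm A) f) =
      clean p (fun A : Fin 3 → ℕ => coeff (Finsupp.equivFunOnFinite.symm A) g) := by
  sorry

/-- STUB S9a (closure of the position family under B's answers): the substitution identities.
Position: `x · Π^p · E^p`, `Π = x^a z^{2e} U y² − x^b W³`, `W = z − x − x z`. -/
theorem stub_closure (p : ℕ) [Fact p.Prime] (κ : Type) [Field κ] [CharP κ p] (a e b : ℕ) (U E : MvPowerSeries (Fin 3) κ) (hU : IsUnit U) (hE : IsUnit E) :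
    let W : MvPowerSeries (Fin 3) κ := X 2 - X 0 - X 0 * X 2
    let Pos : ℕ → ℕ → ℕ → MvPowerSeries (Fin 3) κ → MvPowerSeries (Fin 3) κ → MvPowerSeries (Fin 3) κ :=
      fun a e b U E => X 0 * (X 0 ^ a * X 2 ^ (2 * e) * U * X 1 ^ 2 - X 0 ^ b * W ^ 3) ^ p * E ^ p
    let σP : Fin 3 → MvPowerSeries (Fin 3) κ := ![X 0, X 0 * X 1, X 0 * (X 2 + 1)]
    let σLy : Fin 3 → MvPowerSeries (Fin 3) κ := ![X 0, X 1, X 0 * (X 2 + 1)]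
    let σLz : Fin 3 → MvPowerSeries (Fin 3) κ := ![X 0, X 0 * X 1, X 2]
    let σLx : Fin 3 → MvPowerSeries (Fin 3) κ := ![X 0, X 2 * X 1, X 2]
    -- point centre {x,y,z}, chart x, τ = (0,0,1)
    (subst σP (Pos a e b U E) =
       X 0 ^ (p * min (a + 2 * e + 2) (b + 3)) *
         Pos (a + 2 * e + 2 - min (a + 2 * e + 2) (b + 3)) 0 (b + 3 - min (a + 2 * e + 2) (b + 3))
           ((X 2 + 1) ^ (2 * e) * subst σP U) (subst σP E)
     ∧ IsUnit ((X 2 + 1) ^ (2 * e) * subst σP U) ∧ IsUnit (subst σP E)) ∧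
    -- centre {x,z}, chart x, τ_z = 1
    (subst σLy (Pos a e b U E) =
       X 0 ^ (p * min (a + 2 * e) (b + 3)) *
         Pos (a + 2 * e - min (a + 2 * e) (b + 3)) 0 (b + 3 - min (a + 2 * e) (b + 3))
           ((X 2 + 1) ^ (2 * e) * subst σLy U) (subst σLy E)
     ∧ IsUnit ((X 2 + 1) ^ (2 * e) * subst σLy U) ∧ IsUnit (subst σLy E)) ∧
    -- centre {x,y}, chart x, τ_y = 0
    (subst σLz (Pos a e b U E) =
       X 0 ^ (p * min (a + 2) b) * Pos (a + 2 - min (a + 2) b) e (b - min (a + 2) b) (subst σLz U) (subst σLz E)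
     ∧ IsUnit (subst σLz U) ∧ IsUnit (subst σLz E)) ∧
    -- centre {y,z}, chart z, τ_y = 0
    (subst σLx (Pos a e b U E) = Pos a (e + 1) b (subst σLx U) (subst σLx E)
     ∧ IsUnit (subst σLx U) ∧ IsUnit (subst σLx E)) ∧
    -- centre {x}: the position is x^{p·min a b} times a position
    (Pos a e b U E = X 0 ^ (p * min a b) * Pos (a - min a b) e (b - min a b) U E) := by
  sorry

/-- STUB S9b (orders and cleanliness of positions): the `F`-orders `mF` of a position for the seven
centres, and: a position is clean (no coefficient on `pℕ³`), non-zero, without monomials of degree `≤ 1`. -/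
theorem stub_orders (p : ℕ) [Fact p.Prime] (κ : Type) [Field κ] [CharP κ p] (a e b : ℕ) (U E : MvPowerSeries (Fin 3) κ) (hU : IsUnit U) (hE : IsUnit E) :
    let f : MvPowerSeries (Fin 3) κ :=
      X 0 * (X 0 ^ a * X 2 ^ (2 * e) * U * X 1 ^ 2 - X 0 ^ b * (X 2 - X 0 - X 0 * X 2) ^ 3) ^ p * E ^ p
    let c : (Fin 3 → ℕ) → κ := fun A => coeff (Finsupp.equivFunOnFinite.symm A) f
    mF Finset.univ c = 1 + p * min (a + 2 * e + 2) (b + 3) ∧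
    mF {0, 2} c = 1 + p * min (a + 2 * e) (b + 3) ∧
    mF {0, 1} c = 1 + p * min (a + 2) b ∧
    mF {1, 2} c = 0 ∧
    mF {0} c = 1 + p * min a b ∧
    mF {1} c = 0 ∧
    mF {2} c = 0 ∧
    (∀ d : Fin 3 →₀ ℕ, (∀ j, p ∣ d j) → coeff d f = 0) ∧
    f ≠ 0 ∧
    (∀ d : Fin 3 →₀ ℕ, Finsupp.degree d ≤ 1 → coeff d f = 0) := by
  sorry

end Stubs

end Summit.ResolutionOfSingularities.ResolutionOfSingularities.Theorems.ShadowGameWinR.Negative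

end
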